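import Summits.QuantumFields.YangMills.Theorems.IR.BlockedActivityW
import Summits.QuantumFields.YangMills.Theorems.IR.BlockedActivityKP
import HarnessLib

/-!
# Crux `IR` (stmt-QuantumFields-19354), lane B: the W-currency reductions at the SHARP radius `radiusKP ε = ε∕(13448e²)` (p534919)

Helper module for item `stmt-QuantumFields-19354` (`--supports`; it closes nothing), lane `ym-19354-onsetsc-p2`: `univShellCond_of_blockedActivityW_sharp`
(`BlockedActivityClassW ρ β b n a → ε ≤ 1 → a ≤ radiusKP ε → UnivShellCond ρ β b n ε`) and `clauseI_of_blockedActivityTypW_sharp` — the W-reductions of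
`Theorems/IR/BlockedActivityW` with the Kotecký–Preiss-grade constant of `Theorems/IR/BlockedActivityKP` (THE NUMBER: a⋆(1/3552) ∈ (2.8·10⁻⁹, 2.9·10⁻⁹)).
HONEST FRAMING: constants in a reduction among OPEN statements; not a gap, not Clay.  No `sorry`; axioms ⊆ {propext, Classical.choice, Quot.sound}.
-/

set_option autoImplicit false

noncomputable section

open MeasureTheory
open Literature.MathematicalPhysics.QuantumFieldTheory Literature.MathematicalPhysics.QuantumLattice
open Summit.QuantumFields.YangMills.Cruxes.IR.Tempered (cellEdges windowCells regionEdges)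
open Summit.QuantumFields.YangMills.Cruxes.IR.OnsetFormats (UnivShellCond)
open Summit.QuantumFields.YangMills.Cruxes.IR.FixedMesh (ClauseI)

namespace Summit.QuantumFields.YangMills.Cruxes.IR.BlockedActivity

/-! ## The W-reductions at the SHARP radius `radiusKP ε = ε∕(13448e²)` (p534919) -/

section Sharp

variable {G : Type} [Group G] [TopologicalSpace G] [IsTopologicalGroup G] [CompactSpace G]
  [MeasurableSpace G] [BorelSpace G] {N : ℕ} {ρ : G →* Matrix (Fin N) (Fin N) ℂ} {β : ℝ}
  {w : Fin 4 → ℤ → ℤ} {a ε : ℝ} {n : ℕ}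

/-- **W-reduction, SHARP constant** (`Theorems/IR/BlockedActivityKP`): `a ≤ radiusKP ε = ε∕(13448e²)`, `ε ≤ 1` suffice. -/
theorem univShellCond_of_blockedActivityW_sharp {b : ℕ} (hC : BlockedActivityClassW ρ β b n a) (hε1 : ε ≤ 1)
    (haε : a ≤ radiusKP ε) : UnivShellCond ρ β b n ε := by
  intro w hw Y hY h0 σ σ' hagree f hf hfm hf01
  obtain ⟨R⟩ := hC w hw Y hY h0 σ
  have hσ : σ ∈ WindowAgree w n Y σ := mem_windowAgree_self σ
  obtain ⟨hA, hacc⟩ := smallness_radiusKP (R.perturbation σ hσ).nonneg hε1 haε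
  exact (R.abs_integral_sub_integral_le_sharp hA hσ (mem_windowAgree_of_agree hagree) ⟨hf, hfm, hf01⟩).trans hacc

/-- **W|Typ-reduction, SHARP constant**: `BlockedActivityTypW ρ β w n a Typ → ε ≤ 1 → a ≤ radiusKP ε → ClauseI ρ β w n ε Typ`. -/
theorem clauseI_of_blockedActivityTypW_sharp {Typ : Cell → Set (LGConfig 4 G)} (hC : BlockedActivityTypW ρ β w n a Typ)
    (hε1 : ε ≤ 1) (haε : a ≤ radiusKP ε) : ClauseI ρ β w n ε Typ := by
  intro Y hY h0 σ σ' htyp hagree f hf hfm hf01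
  obtain ⟨R⟩ := hC Y hY h0 σ
  have hσ : σ ∈ WindowAgree w n Y σ ∩ TypicalOff n Y Typ := ⟨mem_windowAgree_self σ, fun c hc hcY => (htyp c hc hcY).1⟩
  have hσ' : σ' ∈ WindowAgree w n Y σ ∩ TypicalOff n Y Typ := ⟨mem_windowAgree_of_agree hagree, fun c hc hcY => (htyp c hc hcY).2⟩
  obtain ⟨hA, hacc⟩ := smallness_radiusKP (R.perturbation σ hσ).nonneg hε1 haε
  exact (R.abs_integral_sub_integral_le_sharp hA hσ hσ' ⟨hf, hfm, hf01⟩).trans hacc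


end Sharp

end Summit.QuantumFields.YangMills.Cruxes.IR.BlockedActivity

end
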